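/-
Copyright (c) 2026 the pub-hodgecm-mathlib formalisation cell (harness21).  Prover seat hodgecm-mathlib-LH4-p04 (g7), req620 Track A «(D-RAM) FOUR-FRAME» squad
(STAGE-1b, row (2); dealer∕pen LH4-plan (g13) WORD #64 (1) «(T5-P-coneΔ-R2)-RamM»; law owner LH4-p07 (g9), (R2)-RamK ★-to-be `toricCensusSum_ramK_cut` is the template), 2026-09-04.
-/
import Summits.HodgeConjecture.HodgeConjecture.Theorems.F0P3cDyRamToricCensusSumRamM   -- ★ (LH4-p04 (g4), this lineage): T5s `toricCensusSum_ramM` (abstract tables, type RamM)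
import HarnessLib

/-!
# Crux `H413`, line LH4 «(D-RAM) FOUR-FRAME» — STAGE-1b, row (2): (T5-P-coneΔ-R2)-RamM «THE TYPE-RamM TORIC CENSUS SUM MINUS THE CUT TOP BAND»
# `ε·Σ_{j ≤ jl} Σ_a q^a·[j + a ≤ C]·(vP − vM) = q^m(2[(jl−g)∕2+1]_q − 2[d_E − d_E%2]_q) − 2·Σ_{a ∈ cut band} q^{a + ⌊(jl+s0)∕2⌋}`,  `jl ≤ C`, `d_E = g + s0`

Cell `hodgecm-mathlib` (D-0151), FLOOR 0, crux item H413 = `stmt-HodgeConjecture-24833`, route of record `HCCMUnconditional`; squad F0∕P3c∕LH4; lane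
`--supports stmt-HodgeConjecture-24833 --as helper` (count-neutral; pays NO tier-0 row).  THEOREMS ONLY (no `def`, no instance, no notation, no `sorry`, default heartbeats).
Organ for LH4-p07 (g9)'s END `levels_typeTwo_censusLaw_*_ofRecord` (= `hLaw` of ★ p859606 ∕ ★ p859730, this seat): the type-RamM third of the (R2) cuts, token-identical in shape to
LH4-p07's (R2)-RamK `toricCensusSum_ramK_cut` (11:26:27Z (i): WITH-AXIS summand `q^a·(if j + a ≤ C then vP j a − vM j a else 0)`) and LH4-p08 (g8)'s (R2)-Unr.

THE OBJECT.  ★ T5s `toricCensusSum_ramM` (LH4-p04 (g4); parameters `g = dΘ∕2`, `s0 = dτ∕2`, `d_E = g + s0`): the type-RamM toric census DIFFERENCE of the two literals over the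
abstract tables `nP nM vP vM` under `hnP hnM hvGen hvOff hvTop`.  Near `1` the census of a template piece `lev_{a′,b′}` is that double sum with ONE extra diagonal indicator `[j + a ≤ C]`,
`C ≥ jl` (★ p859713 (T5-P-cut), `guard_iff_cutoff_ramM`).  THIS FILE evaluates the cut sum from ★ T5s WITHOUT reopening its proof — ★ T5s minus the cut top band:
* §1 `cut_cell_diff_eq_ramM` — beyond the cutoff (`C < j + a`, `m ≤ jl ≤ C`) a cell is never generic; by ★ `hvOff`∕`hvTop`, `vP − vM = ε·2·q^{j − (j+a−m−s0+1)∕2}` on an ALIVE FAR TOP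
  cell (`j + m = jl + a`, `2j + d_E ≤ 2jl + 1`, `m + s0 + 2g < j + a + 2`) and `0` otherwise (near top cells carry the same value on both sides; on far cells `j + a ≥ m + s0` and the
  coefficient is `2` since `j + a − m − s0 + 1 ≥ 2g`);
* §2 `sum_cut_part_eq_ramM` — the cut part is ONE geometric block on the top diagonal: `ε·Σ_j Σ_a q^a·[C < j + a]·(vP − vM) = 2·Σ_{a ∈ band} q^{a + ⌊(jl+s0)∕2⌋}`, band = the columns
  `a ≤ m` whose top cell is cut, far and alive (`C + m < jl + 2a`, `2m + 2g + s0 < jl + 2a + 2`, `2a + d_E ≤ 2m + 1`; the exponent `a + (j − (j+a−m−s0+1)∕2) = a + ⌊(jl+s0)∕2⌋` at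
  `j = jl + a − m` holds in both parities of `jl + s0` — the same top-cell exponent as ★ T5s's own `2x^{⌊(jl+s0)∕2⌋ + a}`);
* §3 **`toricCensusSum_ramM_cut`** — ★ T5s's binders VERBATIM + `(C) (hC : jl ≤ C)`: `ε·Σ_j Σ_a q^a·[j + a ≤ C]·(vP − vM) = q^m(2Σ_{i<(jl−g)∕2+1} q^i − 2Σ_{i<d_E−d_E%2} q^i) −
  2·Σ_{a ∈ band} q^{a + ⌊(jl+s0)∕2⌋}`;  §4 `toricCensusSum_ramM_cut_Ioc` — under `m + 2g + s0 ≤ C + 2` the band is the interval `a ∈ Ioc ((C + m − jl)∕2) ((2m + 1 − d_E)∕2)`;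
  `C ≥ m + jl` (regime (R0)) gives back ★ T5s.
HONEST LABEL.  Count-neutral finite-sum bookkeeping over ℚ on ABSTRACT tables; nothing printed is asserted; no census law is stated; `HC_CM` is proved only modulo the 7 printed citations
(2 remaining named inputs: hLiu418 = `stmt-HodgeConjecture-24832`, h413 = `stmt-HodgeConjecture-24833`) until rung 0 closes.
## References
* [Kottwitz1986BaseChangeUnits] R. E. Kottwitz, *Base change for unit elements of Hecke algebras*, Compositio Math. 60 (1986): §1 pp. 240–241.
* [Rogawski1990] J. D. Rogawski, *Automorphic Representations of Unitary Groups in Three Variables*, Ann. of Math. Stud. 123 (1990): §4.9 Prop. 4.9.1 (b) p. 55, Lemma 4.9.3 p. 56.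
* [Flicker1998UnitaryFL] Y. Z. Flicker, *Elementary proof of the fundamental lemma for a unitary group*, Canad. J. Math. 50 (1998): Prop. 7 p. 84 (the level tables).
* [Serre1979] J.-P. Serre, *Local Fields*, GTM 67 (1979): Ch. V §3 Cor. 3.
-/

set_option autoImplicit false

namespace Summit.HodgeConjecture.HodgeConjecture.Cruxes.H413.F0P3cDyRamToricCensusSumRamMCutoff

open Finset
open Summit.HodgeConjecture.HodgeConjecture.Cruxes.H413.F0P3cDyRamToricCensusSumRamM (toricCensusSum_ramM)

/-! ## §1 A cut cell is an alive far top cell or empty (type RamM letters) -/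

/-- **A CUT CELL IS AN ALIVE FAR TOP CELL OR EMPTY (RamM).**  In the T5s-RamM table frame (`m ≤ jl ≤ C`), a cell `(j, a)` beyond the diagonal cutoff (`C < j + a`) is never generic;
by ★ `hvOff`∕`hvTop`, `vP − vM = ε·2·x^{j − (j+a−m−s0+1)∕2}` on an alive far top cell (`j + m = jl + a`, `2j + (g+s0) ≤ 2jl + 1`, `m + s0 + 2g < j + a + 2`) and `0` otherwise.
[cite: Flicker1998UnitaryFL, Prop. 7 p. 84] [cite: Rogawski1990, §4.9 Lemma 4.9.3 p. 56] -/
theorem cut_cell_diff_eq_ramM (x ε : ℚ) (hε : ε = 1 ∨ ε = -1) {g s0 jl m C : ℕ} (hg : 1 ≤ g) (hm : m ≤ jl) (hC : jl ≤ C) (vP vM : ℕ → ℕ → ℚ)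
    (hvOff : ∀ j a, ¬ (a ≤ m ∧ (j + a ≤ m ∨ (2 * a ≤ m ∧ j + a ≤ jl))) → j + m ≠ jl + a → vP j a = 0 ∧ vM j a = 0)
    (hvTop : ∀ j a, ¬ (a ≤ m ∧ (j + a ≤ m ∨ (2 * a ≤ m ∧ j + a ≤ jl))) → j + m = jl + a →
      (vP j a = if 2 * j + (g + s0) ≤ 2 * jl + 1 ∧ (j + a + 2 ≤ m + s0 + 2 * g ∨ ε = 1) then
          (if j + a < m + s0 then x ^ j else (if 2 * g ≤ j + a - m - s0 + 1 then 2 else 1) * x ^ (j - (j + a - m - s0 + 1) / 2)) else 0) ∧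
      (vM j a = if 2 * j + (g + s0) ≤ 2 * jl + 1 ∧ (j + a + 2 ≤ m + s0 + 2 * g ∨ ε = -1) then
          (if j + a < m + s0 then x ^ j else (if 2 * g ≤ j + a - m - s0 + 1 then 2 else 1) * x ^ (j - (j + a - m - s0 + 1) / 2)) else 0))
    {j a : ℕ} (hcut : C < j + a) :
    vP j a - vM j a = if j + m = jl + a ∧ 2 * j + (g + s0) ≤ 2 * jl + 1 ∧ m + s0 + 2 * g < j + a + 2 then ε * (2 * x ^ (j - (j + a - m - s0 + 1) / 2)) else 0 := by
  have hng : ¬ (a ≤ m ∧ (j + a ≤ m ∨ (2 * a ≤ m ∧ j + a ≤ jl))) := by omega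
  by_cases htop : j + m = jl + a
  · obtain ⟨hP, hM⟩ := hvTop j a hng htop
    rw [hP, hM]
    by_cases halive : 2 * j + (g + s0) ≤ 2 * jl + 1
    · by_cases hfar : m + s0 + 2 * g < j + a + 2
      · have hnn : ¬ j + a + 2 ≤ m + s0 + 2 * g := by omega
        have hlt : ¬ j + a < m + s0 := by omega
        have h2g : 2 * g ≤ j + a - m - s0 + 1 := by omega
        rcases hε with rfl | rfl <;> norm_num [hnn, halive, htop, hfar, hlt, h2g]
      · have hnear : j + a + 2 ≤ m + s0 + 2 * g := by omega
        norm_num [halive, hnear, hfar, htop]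
    · norm_num [halive]
  · obtain ⟨hP, hM⟩ := hvOff j a hng htop
    norm_num [hP, hM, htop]

/-! ## §2 The cut part is one geometric block on the top diagonal -/

/-- **THE CUT PART IS ONE GEOMETRIC BLOCK ON THE TOP DIAGONAL (RamM)**: `ε·Σ_{j ≤ jl} Σ_{a ≤ jl+1} x^a·[C < j + a]·(vP − vM) = 2·Σ_{a ∈ band} x^{a + ⌊(jl+s0)∕2⌋}`, band = the columns
`a ≤ m` whose top cell `j = jl + a − m` is cut, far and alive: `C + m < jl + 2a ∧ 2m + 2g + s0 < jl + 2a + 2 ∧ 2a + (g + s0) ≤ 2m + 1`.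
[cite: Kottwitz1986BaseChangeUnits, §1 pp. 240–241] [cite: Flicker1998UnitaryFL, Prop. 7 p. 84] -/
theorem sum_cut_part_eq_ramM (x ε : ℚ) (hε : ε = 1 ∨ ε = -1) {g s0 jl m C : ℕ} (hg : 1 ≤ g) (hm : m ≤ jl) (hC : jl ≤ C) (vP vM : ℕ → ℕ → ℚ)
    (hvOff : ∀ j a, ¬ (a ≤ m ∧ (j + a ≤ m ∨ (2 * a ≤ m ∧ j + a ≤ jl))) → j + m ≠ jl + a → vP j a = 0 ∧ vM j a = 0)
    (hvTop : ∀ j a, ¬ (a ≤ m ∧ (j + a ≤ m ∨ (2 * a ≤ m ∧ j + a ≤ jl))) → j + m = jl + a →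
      (vP j a = if 2 * j + (g + s0) ≤ 2 * jl + 1 ∧ (j + a + 2 ≤ m + s0 + 2 * g ∨ ε = 1) then
          (if j + a < m + s0 then x ^ j else (if 2 * g ≤ j + a - m - s0 + 1 then 2 else 1) * x ^ (j - (j + a - m - s0 + 1) / 2)) else 0) ∧
      (vM j a = if 2 * j + (g + s0) ≤ 2 * jl + 1 ∧ (j + a + 2 ≤ m + s0 + 2 * g ∨ ε = -1) then
          (if j + a < m + s0 then x ^ j else (if 2 * g ≤ j + a - m - s0 + 1 then 2 else 1) * x ^ (j - (j + a - m - s0 + 1) / 2)) else 0)) :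
    ε * ∑ j ∈ range (jl + 1), ∑ a ∈ range (jl + 2), x ^ a * (if C < j + a then vP j a - vM j a else 0) =
      2 * ∑ a ∈ (range (jl + 2)).filter (fun a => a ≤ m ∧ C + m < jl + 2 * a ∧ 2 * m + 2 * g + s0 < jl + 2 * a + 2 ∧ 2 * a + (g + s0) ≤ 2 * m + 1), x ^ (a + (jl + s0) / 2) := by
  have hεε : ε * ε = 1 := by rcases hε with rfl | rfl <;> norm_num
  rw [Finset.sum_comm, Finset.mul_sum, Finset.sum_filter, Finset.mul_sum]
  refine Finset.sum_congr rfl fun a _ => ?_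
  by_cases ham : a ≤ m
  · -- column `a ≤ m`: only the top cell `j = jl + a - m` can survive the cut
    rw [Finset.sum_eq_single_of_mem (jl + a - m) (by rw [Finset.mem_range]; omega) (fun j hj hne => ?_)]
    · by_cases hcut : C < jl + a - m + a
      · rw [if_pos hcut, cut_cell_diff_eq_ramM x ε hε hg hm hC vP vM hvOff hvTop hcut]
        by_cases hP : a ≤ m ∧ C + m < jl + 2 * a ∧ 2 * m + 2 * g + s0 < jl + 2 * a + 2 ∧ 2 * a + (g + s0) ≤ 2 * m + 1
        · have h1 : jl + a - m + m = jl + a ∧ 2 * (jl + a - m) + (g + s0) ≤ 2 * jl + 1 ∧ m + s0 + 2 * g < jl + a - m + a + 2 := by omega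
          have hexp : a + (jl + a - m - (jl + a - m + a - m - s0 + 1) / 2) = a + (jl + s0) / 2 := by omega
          rw [if_pos h1, if_pos hP, ← hexp, pow_add]
          linear_combination (2 * x ^ a * x ^ (jl + a - m - (jl + a - m + a - m - s0 + 1) / 2)) * hεε
        · have h1 : ¬ (jl + a - m + m = jl + a ∧ 2 * (jl + a - m) + (g + s0) ≤ 2 * jl + 1 ∧ m + s0 + 2 * g < jl + a - m + a + 2) := by omega
          rw [if_neg h1, if_neg hP, mul_zero, mul_zero, mul_zero]
      · have hP : ¬ (a ≤ m ∧ C + m < jl + 2 * a ∧ 2 * m + 2 * g + s0 < jl + 2 * a + 2 ∧ 2 * a + (g + s0) ≤ 2 * m + 1) := by omega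
        rw [if_neg hcut, if_neg hP, mul_zero, mul_zero, mul_zero]
    · -- any other row of the column vanishes under the cut
      by_cases hcut : C < j + a
      · rw [if_pos hcut, cut_cell_diff_eq_ramM x ε hε hg hm hC vP vM hvOff hvTop hcut, if_neg (fun h => hne (by omega)), mul_zero]
      · rw [if_neg hcut, mul_zero]
  · -- column `a > m`: its top row lies beyond `jl`; the whole column vanishes under the cut
    have hP : ¬ (a ≤ m ∧ C + m < jl + 2 * a ∧ 2 * m + 2 * g + s0 < jl + 2 * a + 2 ∧ 2 * a + (g + s0) ≤ 2 * m + 1) := fun h => ham h.1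
    rw [if_neg hP, mul_zero, Finset.sum_eq_zero fun j hj => ?_, mul_zero]
    by_cases hcut : C < j + a
    · rw [Finset.mem_range] at hj
      rw [if_pos hcut, cut_cell_diff_eq_ramM x ε hε hg hm hC vP vM hvOff hvTop hcut, if_neg (fun h => by omega), mul_zero]
    · rw [if_neg hcut, mul_zero]

/-! ## §3 The T5s-RamM weld with a diagonal cutoff -/

/-- **(T5-P-coneΔ-R2)-RamM: THE T5s WELD WITH A DIAGONAL CUTOFF.**  ★ T5s `toricCensusSum_ramM`'s binders VERBATIM (LH4-p04 (g4)) plus a cutoff constant `C` with `jl ≤ C`: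
`ε·Σ_{j ≤ jl} Σ_{a ≤ jl+1} q^a·[j + a ≤ C]·(vP − vM) = q^m·(2Σ_{i<(jl−g)∕2+1} q^i − 2Σ_{i<(g+s0)−(g+s0)%2} q^i) − 2·Σ_{a ∈ band(C)} q^{a + ⌊(jl+s0)∕2⌋}` — ★ T5s minus §2.  At the shifted
tokens `(m₁, jl₁)` of a template piece and `C` its cutoff letter (★ p859713) this is the type-RamM two-literal census difference of `lev_{a′,b′}` near `1` (scope (R2)).
[cite: Kottwitz1986BaseChangeUnits, §1 pp. 240–241] [cite: Rogawski1990, §4.9 Prop. 4.9.1 (b) p. 55, Lemma 4.9.3 p. 56] [cite: Flicker1998UnitaryFL, Prop. 7 p. 84] [cite: Serre1979, Ch. V §3 Cor. 3] -/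
theorem toricCensusSum_ramM_cut (q : ℕ) {g s0 jl m : ℕ} (ε : ℚ) (hq : 2 ≤ q) (hg : 1 ≤ g) (hs0 : 1 ≤ s0) (hjl : jl % 2 = g % 2)
    (hjlS : 3 * g + 2 * s0 ≤ jl + 2 + 2 * ((g + s0) % 2)) (hpar : m % 2 = (g + s0) % 2) (hmS : g + s0 - (g + s0) % 2 ≤ m + 1) (hm : m ≤ jl)
    (hε : ε = 1 ∨ (ε = -1 ∧ jl + 2 ≤ m + 2 * g + s0))
    (nP nM vP vM : ℕ → ℕ → ℚ)
    (hnP : ∀ j a, nP j a = ((if j = 0 then (if a = 0 then 1 else 0) else if j < a then 0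
      else if j - a + 1 = s0 then q ^ j else if j - a + 1 < s0 then (if a = 0 then q ^ j else 0) else if (j - a - s0) % 2 = 1 then 0
      else if a = 0 then (if 2 * g ≤ j - a - s0 then 2 else 1) * q ^ (j - (j - a - s0) / 2)
      else if j - a - s0 + 2 < 2 * g then (q - 1) * q ^ (j - 1 - (j - a - s0) / 2) else if j - a - s0 + 2 = 2 * g then (q - 2) * q ^ (j - 1 - (j - a - s0) / 2)
      else 2 * (q - 1) * q ^ (j - 1 - (j - a - s0) / 2) : ℕ) : ℚ))
    (hnM : ∀ j a, nM j a = ((if j = 0 then (if a = 0 then 1 else 0) else if j < a then 0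
      else if j - a + 1 = s0 then q ^ j else if j - a + 1 < s0 then (if a = 0 then q ^ j else 0) else if (j - a - s0) % 2 = 1 then 0
      else if a = 0 then (if j - a - s0 + 2 ≤ 2 * g then q ^ (j - (j - a - s0) / 2) else 0)
      else if j - a - s0 + 2 < 2 * g then (q - 1) * q ^ (j - 1 - (j - a - s0) / 2) else if j - a - s0 + 2 = 2 * g then q ^ (j - (j - a - s0) / 2) else 0 : ℕ) : ℚ))
    (hvGen : ∀ j a, (a ≤ m ∧ (j + a ≤ m ∨ (2 * a ≤ m ∧ j + a ≤ jl))) → vP j a = nP j a ∧ vM j a = nM j a)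
    (hvOff : ∀ j a, ¬ (a ≤ m ∧ (j + a ≤ m ∨ (2 * a ≤ m ∧ j + a ≤ jl))) → j + m ≠ jl + a → vP j a = 0 ∧ vM j a = 0)
    (hvTop : ∀ j a, ¬ (a ≤ m ∧ (j + a ≤ m ∨ (2 * a ≤ m ∧ j + a ≤ jl))) → j + m = jl + a →
      (vP j a = if 2 * j + (g + s0) ≤ 2 * jl + 1 ∧ (j + a + 2 ≤ m + s0 + 2 * g ∨ ε = 1) then
          (if j + a < m + s0 then (q : ℚ) ^ j else (if 2 * g ≤ j + a - m - s0 + 1 then 2 else 1) * (q : ℚ) ^ (j - (j + a - m - s0 + 1) / 2)) else 0) ∧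
      (vM j a = if 2 * j + (g + s0) ≤ 2 * jl + 1 ∧ (j + a + 2 ≤ m + s0 + 2 * g ∨ ε = -1) then
          (if j + a < m + s0 then (q : ℚ) ^ j else (if 2 * g ≤ j + a - m - s0 + 1 then 2 else 1) * (q : ℚ) ^ (j - (j + a - m - s0 + 1) / 2)) else 0))
    (C : ℕ) (hC : jl ≤ C) :
    ε * ∑ j ∈ range (jl + 1), ∑ a ∈ range (jl + 2), (q : ℚ) ^ a * (if j + a ≤ C then vP j a - vM j a else 0) =
      (q : ℚ) ^ m * (2 * ∑ i ∈ range ((jl - g) / 2 + 1), (q : ℚ) ^ i - 2 * ∑ i ∈ range (g + s0 - (g + s0) % 2), (q : ℚ) ^ i) -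
        2 * ∑ a ∈ (range (jl + 2)).filter (fun a => a ≤ m ∧ C + m < jl + 2 * a ∧ 2 * m + 2 * g + s0 < jl + 2 * a + 2 ∧ 2 * a + (g + s0) ≤ 2 * m + 1), (q : ℚ) ^ (a + (jl + s0) / 2) := by
  have hε' : ε = 1 ∨ ε = -1 := hε.imp_right And.left
  have hsplit : ∀ j a, (q : ℚ) ^ a * (if j + a ≤ C then vP j a - vM j a else 0) =
      (q : ℚ) ^ a * (vP j a - vM j a) - (q : ℚ) ^ a * (if C < j + a then vP j a - vM j a else 0) := fun j a => by
    by_cases h : j + a ≤ C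
    · rw [if_pos h, if_neg (not_lt.2 h), mul_zero, sub_zero]
    · rw [if_neg h, if_pos (not_le.1 h), mul_zero, sub_self]
  simp_rw [hsplit]
  simp only [Finset.sum_sub_distrib]
  rw [mul_sub, toricCensusSum_ramM q ε hq hg hs0 hjl hjlS hpar hmS hm hε nP nM vP vM hnP hnM hvGen hvOff hvTop,
    sum_cut_part_eq_ramM (q : ℚ) ε hε' hg hm hC vP vM hvOff hvTop]

/-! ## §4 The cut band as an interval -/

/-- **THE CUT BAND IS AN INTERVAL (RamM)** once the far condition is implied (`m + 2g + s0 ≤ C + 2`, `m ≤ jl ≤ C`, `g, s0 ≥ 1`): the band of §2 is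
`a ∈ Ioc ((C + m − jl)∕2) ((2m + 1 − (g + s0))∕2)`. [cite: Flicker1998UnitaryFL, Prop. 7 p. 84] -/
theorem filter_band_eq_Ioc_ramM {g s0 jl m C : ℕ} (hg : 1 ≤ g) (hs0 : 1 ≤ s0) (hm : m ≤ jl) (hC : jl ≤ C) (hfar : m + 2 * g + s0 ≤ C + 2) :
    (range (jl + 2)).filter (fun a => a ≤ m ∧ C + m < jl + 2 * a ∧ 2 * m + 2 * g + s0 < jl + 2 * a + 2 ∧ 2 * a + (g + s0) ≤ 2 * m + 1) =
      Finset.Ioc ((C + m - jl) / 2) ((2 * m + 1 - (g + s0)) / 2) := by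
  ext a
  simp only [Finset.mem_filter, Finset.mem_range, Finset.mem_Ioc]
  omega

/-- **(T5-P-coneΔ-R2)-RamM, INTERVAL FORM**: under `m + 2g + s0 ≤ C + 2` the cut weld reads
`… = q^m·(2Σ_{i<(jl−g)∕2+1} q^i − 2Σ_{i<(g+s0)−(g+s0)%2} q^i) − 2·Σ_{a ∈ Ioc ((C+m−jl)∕2) ((2m+1−(g+s0))∕2)} q^{a + ⌊(jl+s0)∕2⌋}`; for `m + jl ≤ C` the interval is empty and ★ T5s is recovered
(regime (R0)). [cite: Kottwitz1986BaseChangeUnits, §1 pp. 240–241] [cite: Flicker1998UnitaryFL, Prop. 7 p. 84] -/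
theorem toricCensusSum_ramM_cut_Ioc (q : ℕ) {g s0 jl m : ℕ} (ε : ℚ) (hq : 2 ≤ q) (hg : 1 ≤ g) (hs0 : 1 ≤ s0) (hjl : jl % 2 = g % 2)
    (hjlS : 3 * g + 2 * s0 ≤ jl + 2 + 2 * ((g + s0) % 2)) (hpar : m % 2 = (g + s0) % 2) (hmS : g + s0 - (g + s0) % 2 ≤ m + 1) (hm : m ≤ jl)
    (hε : ε = 1 ∨ (ε = -1 ∧ jl + 2 ≤ m + 2 * g + s0))
    (nP nM vP vM : ℕ → ℕ → ℚ)
    (hnP : ∀ j a, nP j a = ((if j = 0 then (if a = 0 then 1 else 0) else if j < a then 0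
      else if j - a + 1 = s0 then q ^ j else if j - a + 1 < s0 then (if a = 0 then q ^ j else 0) else if (j - a - s0) % 2 = 1 then 0
      else if a = 0 then (if 2 * g ≤ j - a - s0 then 2 else 1) * q ^ (j - (j - a - s0) / 2)
      else if j - a - s0 + 2 < 2 * g then (q - 1) * q ^ (j - 1 - (j - a - s0) / 2) else if j - a - s0 + 2 = 2 * g then (q - 2) * q ^ (j - 1 - (j - a - s0) / 2)
      else 2 * (q - 1) * q ^ (j - 1 - (j - a - s0) / 2) : ℕ) : ℚ))
    (hnM : ∀ j a, nM j a = ((if j = 0 then (if a = 0 then 1 else 0) else if j < a then 0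
      else if j - a + 1 = s0 then q ^ j else if j - a + 1 < s0 then (if a = 0 then q ^ j else 0) else if (j - a - s0) % 2 = 1 then 0
      else if a = 0 then (if j - a - s0 + 2 ≤ 2 * g then q ^ (j - (j - a - s0) / 2) else 0)
      else if j - a - s0 + 2 < 2 * g then (q - 1) * q ^ (j - 1 - (j - a - s0) / 2) else if j - a - s0 + 2 = 2 * g then q ^ (j - (j - a - s0) / 2) else 0 : ℕ) : ℚ))
    (hvGen : ∀ j a, (a ≤ m ∧ (j + a ≤ m ∨ (2 * a ≤ m ∧ j + a ≤ jl))) → vP j a = nP j a ∧ vM j a = nM j a)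
    (hvOff : ∀ j a, ¬ (a ≤ m ∧ (j + a ≤ m ∨ (2 * a ≤ m ∧ j + a ≤ jl))) → j + m ≠ jl + a → vP j a = 0 ∧ vM j a = 0)
    (hvTop : ∀ j a, ¬ (a ≤ m ∧ (j + a ≤ m ∨ (2 * a ≤ m ∧ j + a ≤ jl))) → j + m = jl + a →
      (vP j a = if 2 * j + (g + s0) ≤ 2 * jl + 1 ∧ (j + a + 2 ≤ m + s0 + 2 * g ∨ ε = 1) then
          (if j + a < m + s0 then (q : ℚ) ^ j else (if 2 * g ≤ j + a - m - s0 + 1 then 2 else 1) * (q : ℚ) ^ (j - (j + a - m - s0 + 1) / 2)) else 0) ∧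
      (vM j a = if 2 * j + (g + s0) ≤ 2 * jl + 1 ∧ (j + a + 2 ≤ m + s0 + 2 * g ∨ ε = -1) then
          (if j + a < m + s0 then (q : ℚ) ^ j else (if 2 * g ≤ j + a - m - s0 + 1 then 2 else 1) * (q : ℚ) ^ (j - (j + a - m - s0 + 1) / 2)) else 0))
    (C : ℕ) (hC : jl ≤ C) (hfar : m + 2 * g + s0 ≤ C + 2) :
    ε * ∑ j ∈ range (jl + 1), ∑ a ∈ range (jl + 2), (q : ℚ) ^ a * (if j + a ≤ C then vP j a - vM j a else 0) =
      (q : ℚ) ^ m * (2 * ∑ i ∈ range ((jl - g) / 2 + 1), (q : ℚ) ^ i - 2 * ∑ i ∈ range (g + s0 - (g + s0) % 2), (q : ℚ) ^ i) -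
        2 * ∑ a ∈ Finset.Ioc ((C + m - jl) / 2) ((2 * m + 1 - (g + s0)) / 2), (q : ℚ) ^ (a + (jl + s0) / 2) := by
  rw [toricCensusSum_ramM_cut q ε hq hg hs0 hjl hjlS hpar hmS hm hε nP nM vP vM hnP hnM hvGen hvOff hvTop C hC, filter_band_eq_Ioc_ramM hg hs0 hm hC hfar]

end Summit.HodgeConjecture.HodgeConjecture.Cruxes.H413.F0P3cDyRamToricCensusSumRamMCutoff
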